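import Summits.BirchSwinnertonDyer.BirchSwinnertonDyer.Theses.EisensteinPrimes
import Summits.BirchSwinnertonDyer.BirchSwinnertonDyer.Theorems.Rank1ResidualX1Isogeny
import Summits.BirchSwinnertonDyer.Rank1Residual.WAll.AltClosersX1DeepWitness
import Summits.BirchSwinnertonDyer.Rank1Residual.X2.ClassClosureEntireFree
import Literature.NumberTheory.EllipticCurves.Rank1Residual.ClassX1Isogeny
import HarnessLib

/-!
# Crux `MazurMCOnX1RankZero` (route `EisensteinPrimes`, item stmt-BirchSwinnertonDyer-19035), line
# `deepwitness` (skeleton of record 3018ca05…): the line certificate and its residue exactness on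
# SEVEN refereed inputs — the conjunct `hasEntireLFunction_rat` of `stub_published` is derived

HONEST FRAMING (cell `bsd-eis`, home `run/shared/lean/pub/bsd-eis/`, seat `bsd-line-x1-p2` g0, D-0154
width prover on crux 5; ladder row A3 = class X1 ∩ {r_an = 0}: good ANOMALOUS Eisenstein prime
`p > 2`, `E[p]` reducible, GV-parity type A). THEOREMS ONLY; nothing here closes the item, nothing is
booked, no fact is restated, every input is a NAMED hypothesis; BSD / Mazur's main conjecture is proved
for NO curve by this file. The crux is OPEN in the refereed record on this leaf (Greenberg–Vatsal 2000
Thm. (1.3) is the GV-parity type; Castella–Grossi–Skinner, Math. Ann. 393 (2025) Thm. D excludes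
`φ|_{G_p} ∈ {1, ω}`, i.e. the anomalous case) and CLAIMED only by the preprint Keller–Yin
arXiv:2402.12781v2 (Thm. 3.0.10).

WHAT THIS FILE RECORDS. The registered stub `stub_published` of the line `deepwitness` is ONE
conjunction of EIGHT refereed inputs by name: `hCT` (Cassels–Tate pairing, bsd.S18), `hSha` (Wuthrich
2014 Prop. 21), `hGZK` (Gross–Zagier–Kolyvagin, bsd.S17), `hmod` (`L(E,s)` entire, BCDT), `hCas`
(Cassels' isogeny invariance, Milne ADT I.7.3), `hW16` (Wuthrich 2014 Thm. 16), `hGr` (Greenberg LNM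
1716 Thm. 4.1), `hPar` (modular parametrisation datum, BCDT). One of the eight is a THEOREM OF THE TREE
given another: `hmod ⇐ hPar` (`Rank1Residual.X2.ClassClosureEntireFree.hasEntireLFunction_rat_of_nonempty_modularParametrizationData`:
a parametrisation datum carries its newform, Diamond–Shurman Thm. 5.10.2 / 8.8.3 continue `L(f,s)`).
Hence the line's conditional closure and its residue exactness rest on SEVEN independent refereed
inputs, not eight:

* §1 `published_of_seven` — the registered signature of `stub_published` (verbatim) from the seven.
* §2 `X1.bsdp_of_deepWitnessAt_five` — the per-pair door in `BSD(E,p)` currency on FIVE inputs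
  (`hCT hSha hGZK hCas hPar`); `mazurMainConjecture_of_deepWitnessAt_seven` — the per-pair door in
  Mazur's currency on seven; `mazurMCOnX1RankZero_of_seven_of_deepWitness` — the LINE CERTIFICATE: the
  crux (route decl BY NAME) from the seven + `hdeep` (= `stub_deepWitness` verbatim).
* §3 `mazurMCOnX1RankZero_iff_deepWitness_of_seven` — RESIDUE EXACTNESS on seven inputs: granted
  them, the crux is EQUIVALENT to `stub_deepWitness`; class-wide the stub is the crux in certificate
  currency (the language switch has teeth per cell only).

IMPORTS: the route file (for the crux type by name) and route-INDEPENDENT modules only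
(`Theorems/Rank1ResidualX1Isogeny` → `…X1Converse`, `Rank1Residual/WAll/AltClosersX1DeepWitness`,
`Rank1Residual/X2/ClassClosureEntireFree`, `Literature/…/ClassX1Isogeny`); it does not import the
companion `Theorems/EisensteinPrimesMazurMCOnX1RankZeroDeepWitness.lean` (k5-c5 g4, eight inputs),
whose §1–§3 it re-threads (theses-cone hygiene).

Numbers, not adjectives: PUB inputs of the line 8 → 7 (derived: 1; dischargeable in the kernel: 0);
open stubs besides PUB: 1 (`stub_deepWitness`, crux-equivalent modulo the seven). References: [cite: Wuthrich2014, Thm. 16 (p. 397) and Prop. 21 (p. 400)]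
[cite: GreenbergLNM1716, Thm. 4.1] [cite: SilvermanAEC2009, Thm. X.4.14] [cite: MilneADT2006, Thm. I.7.3]
[cite: BCDTJAMS2001, Theorem A] [cite: DiamondShurman2005, Thm. 8.8.3 and Thm. 5.10.2]
[cite: Miller2011LMS, Def. 1.1 (arXiv:1010.2431 p. 3)]
-/

noncomputable section

open scoped Classical

open WeierstrassCurve Literature.NumberTheory.EllipticCurves
  Literature.NumberTheory.EllipticCurves.ModularForms
  Literature.NumberTheory.EllipticCurves.Rank1Residual
  Literature.NumberTheory.EllipticCurves.Greenberg1999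
  Summit.BirchSwinnertonDyer.BirchSwinnertonDyer.Theorems.Rank1ResidualX1Defs
  Summit.BirchSwinnertonDyer.BirchSwinnertonDyer.Theorems.Rank1ResidualX1Converse
  Summit.BirchSwinnertonDyer.BirchSwinnertonDyer.Theorems.Rank1ResidualX1Isogeny
  Summit.BirchSwinnertonDyer.Rank1Residual
  Summit.BirchSwinnertonDyer.Rank1Residual.WAll

set_option linter.dupNamespace false
set_option autoImplicit false

namespace Summit.BirchSwinnertonDyer.BirchSwinnertonDyer.Theorems.EisensteinPrimesMazurMCOnX1RankZeroDeepWitnessSeven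

/-! ## §1. The registered `stub_published` conjunction from SEVEN refereed inputs -/

/-- **`stub_published` (its registered signature, verbatim) from SEVEN refereed inputs by name**: the
conjunct `hasEntireLFunction_rat` ("`L(E,s)` is entire for every `E/ℚ`") is DERIVED from the modular
parametrisation datum `hPar` by theorems of the tree (newform of the datum + Diamond–Shurman's analytic
continuation; `X2.ClassClosureEntireFree.hasEntireLFunction_rat_of_nonempty_modularParametrizationData`).
The other seven are passed through. CONDITIONAL bookkeeping; nothing closed.
[cite: BCDTJAMS2001, Theorem A] [cite: DiamondShurman2005, Thm. 8.8.3 and Thm. 5.10.2] -/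
theorem published_of_seven (hCT : exists_casselsTate_pairing (K := ℚ))
    (hSha : Wuthrich2014.sha_dvd_analyticSha) (hGZK : rank_eq_analyticRank_of_analyticRank_le_one)
    (hCas : bsdRHS_eq_of_isIsogenous) (hW16 : Wuthrich2014.charIdeal_dvd_padicLFunction)
    (hGr : greenberg_charValue_rankZero) (hPar : nonempty_modularParametrizationData) :
    exists_casselsTate_pairing (K := ℚ) ∧ Wuthrich2014.sha_dvd_analyticSha ∧
      rank_eq_analyticRank_of_analyticRank_le_one ∧ hasEntireLFunction_rat ∧ bsdRHS_eq_of_isIsogenous ∧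
      Wuthrich2014.charIdeal_dvd_padicLFunction ∧ greenberg_charValue_rankZero ∧
      nonempty_modularParametrizationData :=
  ⟨hCT, hSha, hGZK, X2.ClassClosureEntireFree.hasEntireLFunction_rat_of_nonempty_modularParametrizationData hPar,
    hCas, hW16, hGr, hPar⟩

/-! ## §2. The per-pair door and the line certificate on seven inputs -/

/-- **One deep Ш-witness on one member of the class ⇒ `BSD(E,p)` at a rank-`0` X1 pair, on FIVE
refereed inputs** (`hCT hSha hGZK hCas hPar`; the entire continuation used by the lever
`X1.bsdp_of_casselsTate_of_pow_dvd` and by `analyticRank_eq_zero_iff_holds` is derived from `hPar`):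
class X1 and rank `0` transported along the isogeny, Kato–Wuthrich + Cassels–Tate squareness at `W'`,
Cassels' invariance back to `W` (`Ш(W')` finite, `L(W',1) ≠ 0` by GZK). CONDITIONAL; per pair.
[cite: Wuthrich2014, Prop. 21 (p. 400)] [cite: SilvermanAEC2009, Thm. X.4.14]
[cite: MilneADT2006, Thm. I.7.3] [cite: BCDTJAMS2001, Theorem A] -/
theorem X1.bsdp_of_deepWitnessAt_five (hCT : exists_casselsTate_pairing (K := ℚ))
    (hSha : Wuthrich2014.sha_dvd_analyticSha) (hGZK : rank_eq_analyticRank_of_analyticRank_le_one)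
    (hCas : bsdRHS_eq_of_isIsogenous) (hPar : nonempty_modularParametrizationData)
    (W W' : WeierstrassCurve ℚ) [W.IsElliptic] [W'.IsElliptic] [W.IsGloballyMinimal]
    [W'.IsGloballyMinimal] (hiso : IsIsogenous W W') (p : ℕ) [Fact p.Prime]
    (hX1 : ClassX1 W p) (hr0 : W.analyticRank = 0)
    {q : ℚ} (hq : shaAn W' = (q : ℂ)) {k : ℕ} (hv : padicValRat p q ≤ 2 * k)
    (hdvd : p ^ (2 * k - 1) ∣ W'.shaOrder) : BSDp W p := by
  have hmod : hasEntireLFunction_rat :=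
    X2.ClassClosureEntireFree.hasEntireLFunction_rat_of_nonempty_modularParametrizationData hPar
  have hX1' : ClassX1 W' p := ClassX1.of_isIsogenous hiso hX1
  have hr0' : W'.analyticRank = 0 := (analyticRank_eq_of_isIsogenous' hiso) ▸ hr0
  have h' : BSDp W' p :=
    X1.bsdp_of_casselsTate_of_pow_dvd hCT hSha hGZK hmod W' p (by omega) hX1' hr0' hq hv hdvd
  obtain ⟨-, hfin'⟩ := hGZK W' (by omega)
  have hL' : W'.entireLFunction 1 ≠ 0 := (W'.analyticRank_eq_zero_iff_holds (hmod W')).mp hr0'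
  have hlead : W'.leadingLCoeff ≠ 0 := by
    rwa [W'.leadingLCoeff_eq_of_analyticRank_eq_zero hr0']
  exact Wuthrich2014.bsdp_of_isIsogenous hCas hiso hfin' hlead h'

/-- **The PER-PAIR door at any depth `k` on SEVEN refereed inputs**: one deep Ш-witness on one
globally minimal member `W' ∼ W` of the class of a rank-`0` X1 pair `(W, p)` gives the crux's
conclusion `MazurMainConjecture W p` at that pair (`X1.bsdp_of_deepWitnessAt_five`, then the converse
chain `Rank1ResidualX1Converse.mazurMainConjecture_iff_bsdp`: Wuthrich Thm. 16 `hW16`, Greenberg Thm.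
4.1 `hGr`). This is what ONE row-A3 certificate (`k = 0`: `p ∤ #Ш_an`; `k = 1`: one `p`-isogeny
descent; `k = 2`: a second descent) buys in Mazur's currency at its pair; per pair, NOT a class theorem.
[cite: Wuthrich2014, Thm. 16 (p. 397) and Prop. 21 (p. 400)] [cite: GreenbergLNM1716, Thm. 4.1]
[cite: SilvermanAEC2009, Thm. X.4.14] [cite: MilneADT2006, Thm. I.7.3] -/
theorem mazurMainConjecture_of_deepWitnessAt_seven (hCT : exists_casselsTate_pairing (K := ℚ))
    (hSha : Wuthrich2014.sha_dvd_analyticSha) (hGZK : rank_eq_analyticRank_of_analyticRank_le_one)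
    (hCas : bsdRHS_eq_of_isIsogenous) (hW16 : Wuthrich2014.charIdeal_dvd_padicLFunction)
    (hGr : greenberg_charValue_rankZero) (hPar : nonempty_modularParametrizationData)
    (W W' : WeierstrassCurve ℚ) [W.IsElliptic] [W'.IsElliptic] [W.IsGloballyMinimal]
    [W'.IsGloballyMinimal] (hiso : IsIsogenous W W') (p : ℕ) [Fact p.Prime]
    (hX1 : ClassX1 W p) (hr0 : W.analyticRank = 0)
    {q : ℚ} (hq : shaAn W' = (q : ℂ)) {k : ℕ} (hv : padicValRat p q ≤ 2 * k)
    (hdvd : p ^ (2 * k - 1) ∣ W'.shaOrder) : MazurMainConjecture W p :=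
  (mazurMainConjecture_iff_bsdp hW16 hGr hPar hGZK W p hX1 hr0).mpr
    (X1.bsdp_of_deepWitnessAt_five hCT hSha hGZK hCas hPar W W' hiso p hX1 hr0 hq hv hdvd)

/-- **LINE CERTIFICATE (`deepwitness`) on SEVEN refereed inputs**: the crux `MazurMCOnX1RankZero` (route
decl by name) from `hCT hSha hGZK hCas hW16 hGr hPar` + `hdeep` (= the registered `stub_deepWitness`
verbatim: at every rank-`0` X1 pair some globally minimal member `W'` of the class has `#Ш_an(W') = q`,
`ord_p q ≤ 2k`, `p^(2k-1) ∣ #Ш(W')`). Proof: pair by pair through §2's door, then the class-level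
converse chain `Rank1ResidualX1Converse.mazurMainConjectureOnX1_rankZero_iff`. CONDITIONAL; the item
stays open — class-wide `hdeep` is the crux in certificate currency (§3).
[cite: Wuthrich2014, Thm. 16 (p. 397) and Prop. 21 (p. 400)] [cite: GreenbergLNM1716, Thm. 4.1]
[cite: SilvermanAEC2009, Thm. X.4.14] [cite: MilneADT2006, Thm. I.7.3] -/
theorem mazurMCOnX1RankZero_of_seven_of_deepWitness (hCT : exists_casselsTate_pairing (K := ℚ))
    (hSha : Wuthrich2014.sha_dvd_analyticSha) (hGZK : rank_eq_analyticRank_of_analyticRank_le_one)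
    (hCas : bsdRHS_eq_of_isIsogenous) (hW16 : Wuthrich2014.charIdeal_dvd_padicLFunction)
    (hGr : greenberg_charValue_rankZero) (hPar : nonempty_modularParametrizationData)
    (hdeep : ∀ (W : WeierstrassCurve ℚ) [W.IsElliptic] [W.IsGloballyMinimal] (p : ℕ)
      [Fact p.Prime], ClassX1 W p → W.analyticRank = 0 →
      ∃ (W' : WeierstrassCurve ℚ) (_ : W'.IsElliptic) (_ : W'.IsGloballyMinimal), IsIsogenous W W' ∧
        ∃ q : ℚ, shaAn W' = (q : ℂ) ∧ ∃ k : ℕ, padicValRat p q ≤ 2 * k ∧ p ^ (2 * k - 1) ∣ W'.shaOrder) :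
    Summit.BirchSwinnertonDyer.BirchSwinnertonDyer.Theses.EisensteinPrimes.MazurMCOnX1RankZero :=
  (mazurMainConjectureOnX1_rankZero_iff hW16 hGr hPar hGZK).mpr fun W _ _ p _ hX1 hr0 ↦ by
    obtain ⟨W', iE, iM, hiso, q, hq, k, hv, hdvd⟩ := hdeep W p hX1 hr0
    exact X1.bsdp_of_deepWitnessAt_five hCT hSha hGZK hCas hPar W W' hiso p hX1 hr0 hq hv hdvd

/-! ## §3. Residue exactness on seven inputs -/

/-- **RESIDUE EXACTNESS of the line `deepwitness` on SEVEN refereed inputs**: granted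
`hCT hSha hGZK hCas hW16 hGr hPar`, the crux `MazurMCOnX1RankZero` is EQUIVALENT to its registered
stub `stub_deepWitness`. (⇒: pair by pair `MazurMainConjecture W p ⇒ BSD(W,p)` by the converse chain,
then ty-2's `exists_pow_dvd_shaOrder_of_bsdp` on the curve itself — `W' = W`, `k = ⌈ord_p #Ш(W)/2⌉`,
`Ш` finite by GZK; this direction uses only `hW16 hGr hPar hGZK`. ⇐: §2.) So class-wide the one
non-PUB stub of the line is neither weaker nor stronger than the crux: the line is a change of
currency (Iwasawa-theoretic statement ↔ finite Ш-certificates), with teeth per cell only.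
[cite: Wuthrich2014, Thm. 16 (p. 397) and Prop. 21 (p. 400)] [cite: GreenbergLNM1716, Thm. 4.1]
[cite: Miller2011LMS, Def. 1.1 (arXiv:1010.2431 p. 3)] -/
theorem mazurMCOnX1RankZero_iff_deepWitness_of_seven (hCT : exists_casselsTate_pairing (K := ℚ))
    (hSha : Wuthrich2014.sha_dvd_analyticSha) (hGZK : rank_eq_analyticRank_of_analyticRank_le_one)
    (hCas : bsdRHS_eq_of_isIsogenous) (hW16 : Wuthrich2014.charIdeal_dvd_padicLFunction)
    (hGr : greenberg_charValue_rankZero) (hPar : nonempty_modularParametrizationData) :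
    Summit.BirchSwinnertonDyer.BirchSwinnertonDyer.Theses.EisensteinPrimes.MazurMCOnX1RankZero ↔
    ∀ (W : WeierstrassCurve ℚ) [W.IsElliptic] [W.IsGloballyMinimal] (p : ℕ)
      [Fact p.Prime], ClassX1 W p → W.analyticRank = 0 →
      ∃ (W' : WeierstrassCurve ℚ) (_ : W'.IsElliptic) (_ : W'.IsGloballyMinimal), IsIsogenous W W' ∧
        ∃ q : ℚ, shaAn W' = (q : ℂ) ∧ ∃ k : ℕ, padicValRat p q ≤ 2 * k ∧ p ^ (2 * k - 1) ∣ W'.shaOrder := by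
  refine ⟨fun h W iE iM p _ hX1 hr0 ↦ ?_, mazurMCOnX1RankZero_of_seven_of_deepWitness hCT hSha hGZK hCas
    hW16 hGr hPar⟩
  have hB : BSDp W p := (mazurMainConjecture_iff_bsdp hW16 hGr hPar hGZK W p hX1 hr0).mp (h W p hX1 hr0)
  obtain ⟨-, hfin⟩ := hGZK W (by omega)
  have hB' := hB
  obtain ⟨-, -, q, hq, -⟩ := hB'
  exact ⟨W, iE, iM, isIsogenous_self W, q, hq, exists_pow_dvd_shaOrder_of_bsdp W p hfin hB hq⟩

end Summit.BirchSwinnertonDyer.BirchSwinnertonDyer.Theorems.EisensteinPrimesMazurMCOnX1RankZeroDeepWitnessSeven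

end
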